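import Literature.AlgebraicGeometry.Resolution.LogRefinedChartRefine
import Literature.AlgebraicGeometry.Resolution.LogRegularDimensionBound
import HarnessLib

/-!
# The refined chart ring at a point and its map to the toric chart — Kato (10.3)

`Literature/AlgebraicGeometry/Resolution/LogRefinedChartLift.lean`. Continuation of
`LogRefinedChartRefine.lean` (K. Kato, *Toric singularities*, Amer. J. Math. 116 (1994),
(10.3)). At a prime `𝔓` of the chart algebra `C` (monoid homomorphism `χ : Q → C` extending the
log regular chart `φ : P → A`), the data of the previous files feed the refinement theorem
`LogRegularCompleteStructure.isRegularLocalRing_localization_closedPoint_of_le` over the torus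
base change `A₁ = A_𝔭[X]_𝔮`:

* `PointData` — the d-form data of the chart at `𝔭 = 𝔓 ∩ A` (`exists_dformData_proj'`) together
  with the parameters `t″` of `A₁` (`localization_mvPolynomial_baseChange`); `nonempty_pointData`;
* `KRing`, `KPoint`, `KLoc` — the refined chart ring `K♯ = A₁[T, T′]/(φ̃₁(w) − T^{c̃ w})` of the
  absorbed twisted chart, its closed point and local ring, **regular of dimension `N + d + h`**
  (`isRegularLocalRing_KLoc`);
* `tvec`, `rho_absChart` — the KEY RELATION `ρ(φ̃₁(w)) = ∏ tᵢ^{(c̃ w)ᵢ}` in `C_𝔓` with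
  `t = (χ(bᵢ))_{i ∉ U} ++ ρ(t, t″)`;
* `Lam : K♯_𝔔 → C_𝔓` — the induced local homomorphism (`liftLocalization`).

References: [Kato1994] K. Kato, Toric singularities, Amer. J. Math. 116 (1994), (10.3).
-/

noncomputable section

open IsLocalRing Literature.RingTheory.MvPowerSeries

namespace Literature.AlgebraicGeometry.Resolution

namespace LogRefinedChart

open LogRegularCompleteStructure

universe u

variable {n : ℕ} {A : Type u} [CommRing A] {P : AddSubmonoid (Fin n → ℤ)}
  {φ : Multiplicative P →* A} {C : Type u} [CommRing C] [Algebra A C]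
  {Q : AddSubmonoid (Fin n → ℤ)} {b : Module.Basis (Fin n) ℤ (Fin n → ℤ)} {I : Finset (Fin n)}
  (hQ : IsOrthantLike b I Q) (χ : Multiplicative Q →* C) (𝔓 : Ideal C) [𝔓.IsPrime]
  (hPQ : P ≤ Q)
  (hχ : ∀ p : P, χ (Multiplicative.ofAdd ⟨(p : Fin n → ℤ), hPQ p.2⟩) =
    algebraMap A C (φ (Multiplicative.ofAdd p)))
  (π₀ : (Fin n → ℤ) →ₗ[ℤ] (Fin n → ℤ))
  (hπ₀0 : ∀ v ∈ Submodule.span ℤ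
    (LogChart.faceMonoid P φ (𝔓.comap (algebraMap A C)) : Set (Fin n → ℤ)), π₀ v = 0)
  (hπ₀1 : ∀ v, v - π₀ v ∈ Submodule.span ℤ
    (LogChart.faceMonoid P φ (𝔓.comap (algebraMap A C)) : Set (Fin n → ℤ)))
  (hπ₀2 : ∀ v, π₀ (π₀ v) = π₀ v)
  {e : (Fin n → ℤ) →+ (Fin n → ℤ)}
  (he : LogChart.IsSharpEmbedding P (LogChart.faceMonoid P φ (𝔓.comap (algebraMap A C))) e)

/-! ### The point data -/

variable (A) in
/-- The structure map `A_𝔭 → A₁ = A_𝔭[X]_𝔮`. [cite: Kato1994, (10.3)] -/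
abbrev baseMap : BaseLoc A 𝔓 →+* TorusLoc A hQ χ 𝔓 π₀ :=
  algebraMap (BaseLoc A 𝔓) (TorusLoc A hQ χ 𝔓 π₀)

variable (A) in
/-- `ρ ∘ baseMap = ρ₀`. [cite: Kato1994, (10.3)] -/
theorem rho_baseMap (x : BaseLoc A 𝔓) :
    rho A hQ χ 𝔓 π₀ (baseMap A hQ χ 𝔓 π₀ x) = rho₀ A 𝔓 x := by
  rw [baseMap, IsScalarTower.algebraMap_apply (BaseLoc A 𝔓) (TorusPoly A hQ χ 𝔓 π₀)
    (TorusLoc A hQ χ 𝔓 π₀), MvPolynomial.algebraMap_eq, rho_algebraMap, evalHom_C]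

/-- **The twisted chart** `φ₁ = baseMap ∘ φ′ · u⁻¹` over `A₁`. [cite: Kato1994, (10.3)] -/
def twisted : (Fin n →₀ ℕ) → TorusLoc A hQ χ 𝔓 π₀ :=
  twistChart (baseMap A hQ χ 𝔓 π₀) (LogChart.embChart he (proj' hQ χ 𝔓 π₀))
    (twistUnits hQ χ 𝔓 π₀ he)

/-- `twisted` unfolded. [cite: Kato1994, (10.3)] -/
theorem twisted_apply (w : Fin n →₀ ℕ) :
    twisted hQ χ 𝔓 π₀ he w = baseMap A hQ χ 𝔓 π₀ (LogChart.embChart he (proj' hQ χ 𝔓 π₀) w) *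
      ↑(twistUnits hQ χ 𝔓 π₀ he w)⁻¹ := rfl

/-! ### The chart relations in `C_𝔓` -/

/-- Products of powers split along `Fin.append` (bookkeeping for the absorbed chart). [cite: Kato1994, (10.3)] -/
theorem prod_absorbGlue_pow {R : Type*} [CommMonoid R] {M d : ℕ} (α : Fin M →₀ ℕ) (β : Fin d →₀ ℕ)
    (x : Fin M → R) (y : Fin d → R) :
    ((absorbGlue M d (α, β)).prod fun i m => Fin.append x y i ^ m) =
      (α.prod fun j m => x j ^ m) * β.prod fun k m => y k ^ m := by
  classical
  have hglue : absorbGlue M d (α, β) =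
      Finsupp.mapDomain (Fin.castAdd d) α + Finsupp.mapDomain (Fin.natAdd M) β := by
    simp [absorbGlue]
  rw [hglue, Finsupp.prod_add_index' (fun _ => pow_zero _) (fun _ _ _ => pow_add _ _ _),
    Finsupp.prod_mapDomain_index_inj (Fin.castAdd_injective M d),
    Finsupp.prod_mapDomain_index_inj (Fin.natAdd_injective d M)]
  simp only [Fin.append_left, Fin.append_right]

include hPQ hχ hπ₀1 in
/-- **`ρ₀(φ̄(π′ p)) = ∏_{i ∉ U} χ(bᵢ)^{bᵢ*(p)} · (unit part of π′ p)`** — the sharp chart of the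
base seen in `C_𝔓`. [cite: Kato1994, (3.2), (10.3)] -/
theorem rho₀_sharpChart_proj' (p : P) :
    rho₀ A 𝔓 (LogChart.sharpChart P φ (𝔓.comap (algebraMap A C))
        (proj' hQ χ 𝔓 π₀ (p : Fin n → ℤ))) =
      (∏ i ∈ (unitIdx hQ χ 𝔓)ᶜ, chiLoc χ 𝔓 (Multiplicative.ofAdd ⟨b i, hQ.basis_mem i⟩) ^
          (b.repr (p : Fin n → ℤ) i).toNat) *
        ((Additive.toMul (unitPartAt hQ χ 𝔓 (proj' hQ χ 𝔓 π₀ (p : Fin n → ℤ))) :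
          (Localization.AtPrime 𝔓)ˣ) : Localization.AtPrime 𝔓) := by
  have hπ'1 := sub_proj'_mem_span hQ χ 𝔓 π₀ hπ₀1
  obtain ⟨f₁, hf₁, f₂, hf₂, h1⟩ :=
    LogChart.exists_presentation_proj (P := P) (φ := φ) (𝔭 := 𝔓.comap (algebraMap A C)) hπ'1
      (p : Fin n → ℤ)
  have hmul := LogChart.sharpChart_mul_of_eq_sub P φ (𝔓.comap (algebraMap A C))
    (P.add_mem p.2 hf₂.1) hf₁ h1
  have h2 := congrArg (rho₀ A 𝔓) hmul
  rw [map_mul, rho₀_algebraMap, rho₀_algebraMap,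
    chiLoc_eq_unitPartAt_of_mem_faceMonoid hQ χ 𝔓 hPQ hχ hf₁,
    ← chiLoc_of_mem χ 𝔓 hPQ hχ _ (P.add_mem p.2 hf₂.1),
    chiLoc_eq_prod_mul_unitPartAt hQ χ 𝔓 _ (hPQ (P.add_mem p.2 hf₂.1))] at h2
  -- the non-unit coordinates of `p + f₂` are those of `p`
  have hcoord : ∀ i ∈ (unitIdx hQ χ 𝔓)ᶜ, (b.repr ((p : Fin n → ℤ) + f₂) i).toNat =
      (b.repr (p : Fin n → ℤ) i).toNat := by
    intro i hi
    rw [map_add, Finsupp.add_apply,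
      repr_eq_zero_of_mem_faceMonoid hQ χ 𝔓 hPQ hχ hf₂ (Finset.mem_compl.1 hi), add_zero]
  rw [Finset.prod_congr rfl fun i hi => by rw [hcoord i hi]] at h2
  -- divide by the unit `unitPartAt f₁`
  have h3 : unitPartAt hQ χ 𝔓 (proj' hQ χ 𝔓 π₀ (p : Fin n → ℤ)) =
      unitPartAt hQ χ 𝔓 ((p : Fin n → ℤ) + f₂) - unitPartAt hQ χ 𝔓 f₁ := by
    rw [← map_sub, ← h1]
  rw [h3, toMul_sub, div_eq_mul_inv, Units.val_mul, ← mul_assoc, ← h2, mul_assoc, Units.mul_inv,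
    mul_one]

include hPQ hχ hπ₀0 hπ₀1 in
/-- **`ρ(φ₁(e p)) = ∏_{i ∉ U} χ(bᵢ)^{bᵢ*(p)}`** — the twisted chart in `C_𝔓`: the unit part of
`π′ p` cancels against `ρ(u(e p)) = unit part of π₀(p − σ p)` up to the unit part of `σ p = 1`.
[cite: Kato1994, (10.3)] -/
theorem rho_twisted_embHom (p : P) :
    rho A hQ χ 𝔓 π₀ (twisted hQ χ 𝔓 π₀ he (LogChart.embHom he p)) =
      ∏ i ∈ (unitIdx hQ χ 𝔓)ᶜ, chiLoc χ 𝔓 (Multiplicative.ofAdd ⟨b i, hQ.basis_mem i⟩) ^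
        (b.repr (p : Fin n → ℤ) i).toNat := by
  have hπ'0 : ∀ v ∈ Submodule.span ℤ
      (LogChart.faceMonoid P φ (𝔓.comap (algebraMap A C)) : Set (Fin n → ℤ)),
      proj' hQ χ 𝔓 π₀ v = 0 := fun v hv => proj'_eq_zero_of_mem_span hQ χ 𝔓 hPQ hχ π₀ hπ₀0 hv
  rw [twisted_apply, LogChart.embChart_embHom he hπ'0, map_mul, rho_baseMap,
    rho₀_sharpChart_proj' hQ χ 𝔓 hPQ hχ π₀ hπ₀1 p,
    twistUnits_embHom hQ χ 𝔓 hPQ hχ π₀ hπ₀0 he, rho_inv_torusMonomial, mul_assoc,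
    ← Units.val_mul, ← toMul_neg, ← toMul_add, ← sub_eq_add_neg, ← map_sub]
  have h4 : proj' hQ χ 𝔓 π₀ (p : Fin n → ℤ) - π₀ ((p : Fin n → ℤ) - sigma hQ χ 𝔓 p) =
      sigma hQ χ 𝔓 p := by rw [proj'_apply]; abel
  rw [h4, unitPartAt_sigma, toMul_zero, Units.val_one, mul_one]

include hPQ hχ in
/-- The `T`-monomial of `c(e p)`: `∏ⱼ χ(b_{i_j})^{c(e p)_j} = ∏_{i ∉ U} χ(bᵢ)^{bᵢ*(p)}`.
[cite: Kato1994, (10.3)] -/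
theorem prod_refineMap_pow (p : P) :
    ((refineMap hQ χ 𝔓 he (LogChart.embHom he p)).prod fun j m =>
        chiLoc χ 𝔓 (Multiplicative.ofAdd ⟨b (nonUnitIdx hQ χ 𝔓 j), hQ.basis_mem _⟩) ^ m) =
      ∏ i ∈ (unitIdx hQ χ 𝔓)ᶜ, chiLoc χ 𝔓 (Multiplicative.ofAdd ⟨b i, hQ.basis_mem i⟩) ^
        (b.repr (p : Fin n → ℤ) i).toNat := by
  rw [Finsupp.prod_fintype _ _ fun j => pow_zero _]
  simp_rw [refineMap_embHom hQ χ 𝔓 hPQ hχ he]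
  -- reindex `Fin N ≃ ↥(unitIdx)ᶜ`
  rw [← Finset.prod_attach (unitIdx hQ χ 𝔓)ᶜ]
  refine Fintype.prod_equiv (nonUnitEquiv hQ χ 𝔓).symm _ _ fun j => ?_
  rfl


/-- **Point data at `𝔓`**: the d-form data `(d, t)` of the chart over `A_𝔭` for the adapted
splitting `π'` (with the compatibility units), and the parameters `t″₁, …, t″_h` of the torus
base change `A₁` with `𝔪_{A₁} = 𝔪_{A_𝔭}A₁ + (t″)` and `dim A_𝔭 + h ≤ dim A₁`.
[cite: Kato1994, (10.3)] -/
structure PointData where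
  /-- number of regular parameters of `A_𝔭 / I(𝔭)` -/
  d : ℕ
  /-- the regular parameters, lifted to `A_𝔭` -/
  t₀ : Fin d → BaseLoc A 𝔓
  /-- the d-form data of the embedded chart `φ′ = embChart` for the splitting `π'` -/
  dform : LogChart.DFormData (LogChart.embMonoid he) (LogChart.embChart he (proj' hQ χ 𝔓 π₀)) d t₀
  /-- compatibility `φ′(e p)·v = φ(p)` -/
  compat : ∀ p : P, ∃ v : (BaseLoc A 𝔓)ˣ,
    LogChart.embChart he (proj' hQ χ 𝔓 π₀) (LogChart.embHom he p) * ↑v =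
      algebraMap A (BaseLoc A 𝔓) (LogChart.val P φ (p : Fin n → ℤ))
  /-- `A_𝔭 → A₁` is local -/
  isLocalHom : IsLocalHom (baseMap A hQ χ 𝔓 π₀)
  /-- number of extra parameters of `A₁` -/
  h : ℕ
  /-- the extra parameters `t″` of `A₁` -/
  t'' : Fin h → TorusLoc A hQ χ 𝔓 π₀
  mem'' : ∀ k, t'' k ∈ maximalIdeal (TorusLoc A hQ χ 𝔓 π₀)
  gen₁ : maximalIdeal (TorusLoc A hQ χ 𝔓 π₀) ≤
    (maximalIdeal (BaseLoc A 𝔓)).map (baseMap A hQ χ 𝔓 π₀) ⊔ Ideal.span (Set.range t'')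
  dim₁ : ringKrullDim (BaseLoc A 𝔓) + h ≤ ringKrullDim (TorusLoc A hQ χ 𝔓 π₀)

include hPQ hχ hπ₀0 hπ₀1 in
/-- **Point data exist** at every prime of the chart algebra of a Noetherian log regular chart.
[cite: Kato1994, (10.3)] -/
theorem nonempty_pointData [IsNoetherianRing A] (hP : P.FG)
    (hreg : LogChart.IsLogRegularAt P φ (𝔓.comap (algebraMap A C))) :
    Nonempty (PointData hQ χ 𝔓 π₀ he) := by
  obtain ⟨d, t₀, hD, hcompat⟩ := exists_dformData_proj' hQ χ 𝔓 hPQ hχ π₀ hπ₀0 hπ₀1 he hP hreg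
  obtain ⟨hloc, h, t'', ht'', hgen₁, hdim₁⟩ :=
    localization_mvPolynomial_baseChange (torusPrime A hQ χ 𝔓 π₀) (torusPrime_comap_C A hQ χ 𝔓 π₀)
  exact ⟨⟨d, t₀, hD, hcompat, hloc, h, t'', ht'', hgen₁, hdim₁⟩⟩

variable {hQ χ 𝔓 π₀ he} (𝒟 : PointData hQ χ 𝔓 π₀ he)

/-! ### The absorbed twisted chart and the refined chart ring `K♯` -/

/-- All the parameters `(t, t″)` of `A₁`. [cite: Kato1994, (10.3)] -/
def params : Fin (𝒟.d + 𝒟.h) → TorusLoc A hQ χ 𝔓 π₀ :=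
  Fin.append (baseMap A hQ χ 𝔓 π₀ ∘ 𝒟.t₀) 𝒟.t''

/-- The parameters lie in `𝔪_{A₁}`. [cite: Kato1994, (10.3)] -/
theorem params_mem (k : Fin (𝒟.d + 𝒟.h)) : params 𝒟 k ∈ maximalIdeal (TorusLoc A hQ χ 𝔓 π₀) := by
  haveI := 𝒟.isLocalHom
  rw [params]
  induction k using Fin.addCases with
  | left k =>
    rw [Fin.append_left]
    exact (mem_maximalIdeal _).2 (map_nonunit (baseMap A hQ χ 𝔓 π₀) _
      ((mem_maximalIdeal _).1 (𝒟.dform.param_mem k)))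
  | right k => rw [Fin.append_right]; exact 𝒟.mem'' k

/-- **The absorbed twisted chart** `φ̃₁(w₁, w₂) = φ₁(w₁) (t, t″)^{w₂}`. [cite: Kato1994, (10.3)] -/
def absChart : (Fin (n + (𝒟.d + 𝒟.h)) →₀ ℕ) → TorusLoc A hQ χ 𝔓 π₀ :=
  absorbChart (twisted hQ χ 𝔓 π₀ he) (params 𝒟)

/-- **The absorbed refinement** `c̃(w₁, w₂) = (c w₁, w₂)`. [cite: Kato1994, (10.3)] -/
def absMap : (Fin (n + (𝒟.d + 𝒟.h)) →₀ ℕ) → Fin (refineRank hQ χ 𝔓 + (𝒟.d + 𝒟.h)) →₀ ℕ :=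
  absorbMap (d := 𝒟.d + 𝒟.h) (refineMap hQ χ 𝔓 he)

/-- **The absorbed monoid** `P̃ = e(P) × ℕ^{d+h}`. [cite: Kato1994, (10.3)] -/
abbrev absMonoid : AddSubmonoid (Fin (n + (𝒟.d + 𝒟.h)) →₀ ℕ) :=
  absorbMonoid (LogChart.embMonoid he) (𝒟.d + 𝒟.h)

include hPQ hχ hπ₀0

include 𝒟 in
/-- `φ₁(0) = 1`. [cite: Kato1994, (10.3)] -/
theorem twisted_zero : twisted hQ χ 𝔓 π₀ he 0 = 1 :=
  twistChart_zero _ (𝒟.dform.map_zero) (twistUnits_zero hQ χ 𝔓 hPQ hχ π₀ hπ₀0 he)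

include 𝒟 in
/-- `φ₁` is multiplicative on `P′`. [cite: Kato1994, (10.3)] -/
theorem twisted_add : ∀ a ∈ LogChart.embMonoid he, ∀ b ∈ LogChart.embMonoid he,
    twisted hQ χ 𝔓 π₀ he (a + b) = twisted hQ χ 𝔓 π₀ he a * twisted hQ χ 𝔓 π₀ he b :=
  twistChart_add _ 𝒟.dform.map_add (twistUnits_add hQ χ 𝔓 hPQ hχ π₀ hπ₀0 he)

omit hPQ hχ hπ₀0 in
include 𝒟 in
/-- `φ₁(P′ ∖ 0) ⊆ 𝔪_{A₁}`. [cite: Kato1994, (10.3)] -/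
theorem twisted_mem : ∀ w ∈ LogChart.embMonoid he, w ≠ 0 →
    twisted hQ χ 𝔓 π₀ he w ∈ maximalIdeal (TorusLoc A hQ χ 𝔓 π₀) := by
  haveI := 𝒟.isLocalHom
  exact twistChart_mem_maximalIdeal _ 𝒟.dform.mem_maximalIdeal

/-- `φ̃₁(0) = 1`. [cite: Kato1994, (10.3)] -/
theorem absChart_zero : absChart 𝒟 0 = 1 :=
  absorbChart_zero (twisted_zero hPQ hχ hπ₀0 𝒟) _

omit hPQ hχ hπ₀0 in
/-- `φ̃₁(P̃ ∖ 0) ⊆ 𝔪_{A₁}`. [cite: Kato1994, (10.3)] -/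
theorem absChart_mem : ∀ w ∈ absMonoid 𝒟, w ≠ 0 →
    absChart 𝒟 w ∈ maximalIdeal (TorusLoc A hQ χ 𝔓 π₀) :=
  absorbChart_mem_maximalIdeal (twisted_mem 𝒟) (params_mem 𝒟)

omit hPQ hχ hπ₀0 in
/-- `φ̃₁(w₁, 0) = φ₁(w₁)`. [cite: Kato1994, (10.3)] -/
theorem absChart_absorbGlue_zero (w₁ : Fin n →₀ ℕ) :
    absChart 𝒟 (absorbGlue n (𝒟.d + 𝒟.h) (w₁, 0)) = twisted hQ χ 𝔓 π₀ he w₁ :=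
  absorbChart_absorbGlue_zero _ _ w₁

/-- `φ̃₁(0, δ_k) = t_k`. [cite: Kato1994, (10.3)] -/
theorem absChart_absorbGlue_single (k : Fin (𝒟.d + 𝒟.h)) :
    absChart 𝒟 (absorbGlue n (𝒟.d + 𝒟.h) (0, Finsupp.single k 1)) = params 𝒟 k :=
  absorbChart_absorbGlue_single (twisted_zero hPQ hχ hπ₀0 𝒟) _ k

omit hPQ hχ hπ₀0 in
/-- `c̃(w₁, w₂) = (c w₁, w₂)`. [cite: Kato1994, (10.3)] -/
theorem absMap_absorbGlue (w₁ : Fin n →₀ ℕ) (w₂ : Fin (𝒟.d + 𝒟.h) →₀ ℕ) :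
    absMap 𝒟 (absorbGlue n (𝒟.d + 𝒟.h) (w₁, w₂)) =
      absorbGlue (refineRank hQ χ 𝔓) (𝒟.d + 𝒟.h) (refineMap hQ χ 𝔓 he w₁, w₂) := by
  rw [absMap, absorbMap, absorbProj₁_absorbGlue, absorbProj₂_absorbGlue]

omit hπ₀0 in
/-- `c̃(0) = 0`. [cite: Kato1994, (10.3)] -/
theorem absMap_zero : absMap 𝒟 0 = 0 :=
  absorbMap_zero (refineMap_zero hQ χ 𝔓 hPQ hχ he)

omit hπ₀0 in
/-- `c̃` is kernel-free on `P̃`. [cite: Kato1994, (10.3)] -/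
theorem absMap_ne_zero : ∀ w ∈ absMonoid 𝒟, w ≠ 0 → absMap 𝒟 w ≠ 0 :=
  absorbMap_ne_zero (refineMap_ne_zero hQ χ 𝔓 hPQ hχ he)

omit hPQ hχ hπ₀0 in
/-- **The refined chart ring** `K♯ = A₁[T₁..T_N, T′₁..T′_{d+h}]/(φ̃₁(w) − T^{c̃ w})`.
[cite: Kato1994, (10.3)] -/
abbrev KRing : Type u := RefinementRing (absChart 𝒟) (absMap 𝒟) (absMonoid 𝒟)

/-- **Its closed point** `𝔔 = (𝔪_{A₁}, T, T′)`. [cite: Kato1994, (10.3)] -/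
def KPoint : Ideal (KRing 𝒟) :=
  closedPoint (absChart 𝒟) (absMap 𝒟) (absMonoid 𝒟) (absChart_zero hPQ hχ hπ₀0 𝒟)
    (absChart_mem 𝒟) (absMap_zero hPQ hχ 𝒟) (absMap_ne_zero hPQ hχ 𝒟)

/-- `𝔔` is maximal. [cite: Kato1994, (10.3)] -/
instance isMaximal_KPoint : (KPoint hPQ hχ hπ₀0 𝒟).IsMaximal := isMaximal_closedPoint _ _ _ _

/-- **The local ring `K♯_𝔔`**. [cite: Kato1994, (10.3)] -/
abbrev KLoc : Type u := Localization.AtPrime (KPoint hPQ hχ hπ₀0 𝒟)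

/-- **Kato (10.3) at the point: `K♯_𝔔` is a regular local ring of dimension `N + d + h`.**
[cite: Kato1994, (10.3)] -/
theorem isRegularLocalRing_KLoc [IsNoetherianRing A] (hP : P.FG) :
    IsRegularLocalRing (KLoc hPQ hχ hπ₀0 𝒟) ∧
      ringKrullDim (KLoc hPQ hχ hπ₀0 𝒟) = (refineRank hQ χ 𝔓 + (𝒟.d + 𝒟.h) : ℕ) := by
  haveI := 𝒟.isLocalHom
  have hdim : ((monoidPowerSeries.rank (LogChart.embMonoid he) + (𝒟.d + 𝒟.h) : ℕ) : WithBot ℕ∞) ≤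
      ringKrullDim (TorusLoc A hQ χ 𝔓 π₀) := by
    refine le_trans ?_ 𝒟.dim₁
    calc ((monoidPowerSeries.rank (LogChart.embMonoid he) + (𝒟.d + 𝒟.h) : ℕ) : WithBot ℕ∞)
        = ((monoidPowerSeries.rank (LogChart.embMonoid he) + 𝒟.d : ℕ) : WithBot ℕ∞) + 𝒟.h := by
          push_cast; ring
      _ ≤ ringKrullDim (BaseLoc A 𝔓) + 𝒟.h := add_le_add 𝒟.dform.rank_le le_rfl
  exact isRegularLocalRing_localization_closedPoint_of_le (LogChart.embMonoid_fg he hP)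
    (twisted_zero hPQ hχ hπ₀0 𝒟) (twisted_add hPQ hχ hπ₀0 𝒟) (twisted_mem 𝒟) (params_mem 𝒟)
    (maximalIdeal_le_span_twistChart _ 𝒟.dform.gen 𝒟.gen₁) hdim
    (refineMap_zero hQ χ 𝔓 hPQ hχ he) (refineMap_add hQ χ 𝔓 hPQ hχ he)
    (refineMap_ne_zero hQ χ 𝔓 hPQ hχ he) (refineMap_finite_fibre hQ χ 𝔓 hPQ hχ he hP)

/-- `𝔪_{A₁}` is generated by the absorbed chart. [cite: Kato1994, (10.3)] -/
theorem maximalIdeal_le_span_absChart :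
    maximalIdeal (TorusLoc A hQ χ 𝔓 π₀) ≤
      Ideal.span (absChart 𝒟 '' {w | w ∈ absMonoid 𝒟 ∧ w ≠ 0}) :=
  maximalIdeal_le_span_absorbChart (twisted_zero hPQ hχ hπ₀0 𝒟)
    (maximalIdeal_le_span_twistChart _ 𝒟.dform.gen 𝒟.gen₁)

/-- **`𝔔 = (X₁, …, X_{N+d+h})`**. [cite: Kato1994, (10.3)] -/
theorem KPoint_eq_span :
    KPoint hPQ hχ hπ₀0 𝒟 = Ideal.span (Set.range fun i : Fin (refineRank hQ χ 𝔓 + (𝒟.d + 𝒟.h)) =>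
      Ideal.Quotient.mk (refinementIdeal (absChart 𝒟) (absMap 𝒟) (absMonoid 𝒟)) (MvPolynomial.X i)) :=
  closedPoint_eq_span_X _ _ _ _ (maximalIdeal_le_span_absChart hPQ hχ hπ₀0 𝒟)

/-! ### The relation `ρ(φ̃₁ w) = t^{c̃ w}` -/

omit hPQ hχ hπ₀0 in
/-- **The images of the variables**: `Tⱼ ↦ χ(b_{i_j})` (`i_j` the non-unit indices) and
`T′_k ↦ ρ(t_k), ρ(t″_k)`. [cite: Kato1994, (10.3)] -/
def tvec : Fin (refineRank hQ χ 𝔓 + (𝒟.d + 𝒟.h)) → Localization.AtPrime 𝔓 :=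
  Fin.append
    (fun j => chiLoc χ 𝔓 (Multiplicative.ofAdd ⟨b (nonUnitIdx hQ χ 𝔓 j), hQ.basis_mem _⟩))
    (rho A hQ χ 𝔓 π₀ ∘ params 𝒟)

omit hPQ hχ hπ₀0 in
/-- All `tvec i` lie in `𝔪_{C_𝔓}`. [cite: Kato1994, (10.3)] -/
theorem tvec_mem (i : Fin (refineRank hQ χ 𝔓 + (𝒟.d + 𝒟.h))) :
    tvec 𝒟 i ∈ maximalIdeal (Localization.AtPrime 𝔓) := by
  rw [tvec]
  induction i using Fin.addCases with
  | left j => rw [Fin.append_left]; exact chiLoc_mem_maximalIdeal hQ χ 𝔓 (nonUnitIdx_not_mem hQ χ 𝔓 j)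
  | right k =>
    rw [Fin.append_right]
    exact (mem_maximalIdeal _).2 (map_nonunit (rho A hQ χ 𝔓 π₀) _
      ((mem_maximalIdeal _).1 (params_mem 𝒟 k)))

include hπ₀1 in
/-- **THE KEY RELATION** `ρ(φ̃₁(w)) = ∏ᵢ tvecᵢ^{(c̃ w)ᵢ}` for `w ∈ P̃` — the hypothesis of the
universal property `LogRegularRefinementChart.lift`. [cite: Kato1994, (10.3)] -/
theorem rho_absChart : ∀ w ∈ absMonoid 𝒟,
    rho A hQ χ 𝔓 π₀ (absChart 𝒟 w) = (absMap 𝒟 w).prod fun i m => tvec 𝒟 i ^ m := by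
  intro w hw
  have hw₁ : absorbProj₁ n (𝒟.d + 𝒟.h) w ∈ LogChart.embMonoid he := hw
  obtain ⟨p, hp⟩ := (LogChart.mem_embMonoid he).1 hw₁
  rw [absChart, absorbChart, absMap, absorbMap, tvec, prod_absorbGlue_pow, map_mul, ← hp,
    rho_twisted_embHom hQ χ 𝔓 hPQ hχ π₀ hπ₀0 hπ₀1 he p,
    ← prod_refineMap_pow hQ χ 𝔓 hPQ hχ he p, map_finsuppProd]
  simp only [map_pow, Function.comp_apply]

/-! ### The map `Λ : K♯_𝔔 → C_𝔓` -/

include hπ₀1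

/-- **`Λ : K♯_𝔔 → C_𝔓`**, induced by `ρ : A₁ → C_𝔓`, `Tⱼ ↦ χ(b_{i_j})`, `T′_k ↦ ρ(t_k)`.
[cite: Kato1994, (10.3)] -/
def Lam : KLoc hPQ hχ hπ₀0 𝒟 →+* Localization.AtPrime 𝔓 :=
  liftLocalization (absChart_zero hPQ hχ hπ₀0 𝒟) (absChart_mem 𝒟) (absMap_zero hPQ hχ 𝒟)
    (absMap_ne_zero hPQ hχ 𝒟) (rho A hQ χ 𝔓 π₀) (tvec 𝒟)
    (rho_absChart hPQ hχ hπ₀0 hπ₀1 𝒟) (tvec_mem 𝒟)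
    (maximalIdeal_le_span_absChart hPQ hχ hπ₀0 𝒟)

/-- `Λ` on the image of `K♯`. [cite: Kato1994, (10.3)] -/
theorem Lam_algebraMap (x : KRing 𝒟) :
    Lam hPQ hχ hπ₀0 hπ₀1 𝒟 (algebraMap (KRing 𝒟) (KLoc hPQ hχ hπ₀0 𝒟) x) =
      lift (absChart 𝒟) (absMap 𝒟) (absMonoid 𝒟) (rho A hQ χ 𝔓 π₀) (tvec 𝒟)
        (rho_absChart hPQ hχ hπ₀0 hπ₀1 𝒟) x :=
  liftLocalization_algebraMap _ _ _ _ _ _ _ _ _ x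

/-- `Λ` on constants from `A₁`. [cite: Kato1994, (10.3)] -/
theorem Lam_C (a : TorusLoc A hQ χ 𝔓 π₀) :
    Lam hPQ hχ hπ₀0 hπ₀1 𝒟 (algebraMap (KRing 𝒟) (KLoc hPQ hχ hπ₀0 𝒟)
      (Ideal.Quotient.mk _ (MvPolynomial.C a))) = rho A hQ χ 𝔓 π₀ a := by
  rw [Lam_algebraMap, lift_mk_C]

/-- `Λ` on the variables. [cite: Kato1994, (10.3)] -/
theorem Lam_X (i : Fin (refineRank hQ χ 𝔓 + (𝒟.d + 𝒟.h))) :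
    Lam hPQ hχ hπ₀0 hπ₀1 𝒟 (algebraMap (KRing 𝒟) (KLoc hPQ hχ hπ₀0 𝒟)
      (Ideal.Quotient.mk _ (MvPolynomial.X i))) = tvec 𝒟 i := by
  rw [Lam_algebraMap, lift_mk_X]

/-- `Λ` is a local homomorphism. [cite: Kato1994, (10.3)] -/
instance isLocalHom_Lam : IsLocalHom (Lam hPQ hχ hπ₀0 hπ₀1 𝒟) := by
  refine ⟨fun x hx => ?_⟩
  by_contra hnu
  have hmem : x ∈ maximalIdeal (KLoc hPQ hχ hπ₀0 𝒟) := (mem_maximalIdeal _).2 (mem_nonunits_iff.2 hnu)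
  have h1 := map_maximalIdeal_liftLocalization_le (absChart_zero hPQ hχ hπ₀0 𝒟) (absChart_mem 𝒟)
    (absMap_zero hPQ hχ 𝒟) (absMap_ne_zero hPQ hχ 𝒟) (rho A hQ χ 𝔓 π₀) (tvec 𝒟)
    (rho_absChart hPQ hχ hπ₀0 hπ₀1 𝒟) (tvec_mem 𝒟)
    (maximalIdeal_le_span_absChart hPQ hχ hπ₀0 𝒟) (Ideal.mem_map_of_mem _ hmem)
  exact (mem_nonunits_iff.1 ((mem_maximalIdeal _).1 h1)) hx

end LogRefinedChart

end Literature.AlgebraicGeometry.Resolution
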